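import Literature.Computability.MetaComplexity.NCIPS
import Literature.Barriers.ValiantsHypothesis.NoncommutativeExtensions
import HarnessLib

/-!
# Non-commutative IPS certificates written as non-commutative formulas (Li–Tzameret–Wang)

Definition request `defn-NCFormulaIPSCertificate` (route `PneNP/CnfIdealGenLength`, support item
`FregeShortensGenLength`), extending `NCIPS.lean`, whose module docstring defers exactly this:
"non-commutative formulas … and their size, the NC-IPS refutation-as-formula … (for a later file)".

## Sources

F. Li, I. Tzameret, Z. Wang, *Characterizing propositional proofs as noncommutative formulas*,
SIAM J. Comput. 47 (2018) = arXiv:1412.8746 [LiTzameretWang2018]: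
* §1.3.2 and Def. 2.1 (arXiv Def. 9) — a non-commutative formula is a fan-in-two ordered tree with
  leaves labelled by variables or field elements and internal nodes `+`, `×`; "a product gate computes
  the noncommutative product of the polynomials computed by its incoming nodes according to the order
  of the edges"; "the size of a noncommutative formula `f` is the total number of nodes in its
  underlying tree";
* Def. 1.2 (arXiv Def. 2 = Def. 14) — NON-COMMUTATIVE IPS: for a system `F₁(x̄) = … = F_m(x̄) = 0`
  in `𝔽⟨x₁,…,x_n⟩` containing the Boolean axioms `x_i (1 - x_i)` and the commutator axioms
  `x_i x_j - x_j x_i`, a certificate is `𝔉(x̄, ȳ) ∈ 𝔽⟨x̄, ȳ⟩` with `𝔉(x̄, 0̄) = 0` and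
  `𝔉(x̄, F₁(x̄), …, F_m(x̄)) = 1`; "we always assume that the non-commutative IPS refutation is
  written as a non-commutative formula. Hence the size of a non-commutative IPS refutation is the
  minimal size of a non-commutative formula computing [it]";
* Def. 1.3 (arXiv Def. 3) — the translation `tr` of propositional formulas: `tr(x_i) := x_i`,
  `tr(false) := 1`, `tr(true) := 0`, `tr(¬T) := 1 - tr(T)`, `tr(T₁ ∨ T₂) := tr(T₁)·tr(T₂)`,
  `tr(T₁ ∧ T₂) := 1 - (1 - tr(T₁))(1 - tr(T₂))`; "`T` is a propositional tautology iff the polynomial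
  computed by `tr(T)` is `0` for every 0-1 assignment"; Thm. 1.4 (arXiv Thm. 1) asks for "a
  non-commutative IPS certificate of `tr(¬T)`".

## Content

* SYNTAX is the tree's `Literature.Barriers.ValiantsHypothesis.NCFormula R σ` (`var/const/add/mul`,
  `size` = number of nodes — the same count as LTW's), re-used, not re-declared.  Added here, as
  dot-notation extensions declared with their absolute names (CONVENTIONS §2): the evaluation
  `NCFormula.aeval v` of a formula in any `R`-algebra at leaf values `v`, and the FREE-ALGEBRA
  SEMANTICS `NCFormula.evalFree : NCFormula R σ → MonoidAlgebra R (FreeMonoid σ)` = the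
  non-commutative polynomial computed by the formula (product gate ↦ ordered product), with
  `aeval v 𝔉 = (substitution x_i ↦ v i) (evalFree 𝔉)` (`lift_evalFree`) and functoriality
  (`map_aeval`).  (The existing `NCFormula.eval` is the Hrubeš–Yehudayoff semantics into the
  COMMUTATIVE-monomial algebra and is not touched.)
* `NCIPS.HasFormulaCertificateFor R s P` — LTW Def. 1.2 for the system
  {Boolean axioms, commutator axioms (the tree's `NCIPS.IsAxiom`, finitely many, those actually
  used), `P`}: there is a non-commutative formula `𝔉` of size `≤ s` over the letters `x_i`,
  placeholders `y_j` and one placeholder `z`, with `𝔉(x̄, 0̄, 0) = 0` and `𝔉(x̄, ḡ, P) = 1`.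
* `NCIPS.HasFormulaCertificate R s φ := HasFormulaCertificateFor R s (1 - clauseProduct R φ)` —
  the CNF `φ` asserted TRUE is the equation `tr(φ) = 1 - P_φ = 0` (`NCIPS.lean`: `clauseProduct`
  is the polynomial computed by `1 - tr(φ)`).
* `NCIPS.tr R T` — LTW's translation of a propositional formula `T : PropForm ν` (the tree's
  `Literature.Computability.Complexity.PropForm`) as a non-commutative polynomial, in THIS
  DIRECTORY'S CONVENTION `1 = true` fixed in `NCIPS.lean` (so `tr(x_i) = 1 - x_i`; LTW's `0 = true`
  convention differs by the involution `x_i ↦ 1 - x_i`, which fixes the Boolean/commutator ideal and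
  changes formula sizes by at most a constant per leaf); `NCIPS.HasFormulaCertificateOfTaut R s T :=
  HasFormulaCertificateFor R s (tr R (¬T))` — the shape of LTW Thm. 1.4.
* PROVED: `boolEval_tr` (`tr(T)` is `0` at the 0-1 points satisfying `T`, `1` elsewhere — "T is a
  tautology iff tr(T) = 0 for every 0-1 assignment"), soundness `HasFormulaCertificateFor.ne_zero`
  (a certified `P` has no 0-1 root), `HasFormulaCertificate.not_satisfiable`,
  `HasFormulaCertificateOfTaut.isTautology`, monotonicity in `s`, and `tr_clause`/`tr_cnf`-type
  identities linking `tr` with `litWord`/`clauseWord`/`clauseProduct` on literals and clauses.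

No named facts (LTW Thm. 1.4 / 1.7 are for a later file); nothing about Frege proofs here.
-/

namespace Literature.Barriers.ValiantsHypothesis.NCFormula

universe u v w

variable {R : Type u} [CommSemiring R] {σ : Type v}

/-- **Evaluation of a non-commutative formula in an `R`-algebra `B`** at leaf values `v : σ → B`:
leaves compute `v i` resp. the scalar `c`, a plus gate the sum, a product gate the ORDERED product of
its children ("according to the order of the edges").  Declared with its absolute name as a
dot-notation extension of the tree's `NCFormula` (syntax of Hrubeš–Yehudayoff / LTW formulas).
[cite: LiTzameretWang2018, Def. 2.1 (arXiv Def. 9: how a noncommutative formula computes)] -/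
def aeval {B : Type w} [Semiring B] [Algebra R B] (v : σ → B) : NCFormula R σ → B
  | var i => v i
  | const c => algebraMap R B c
  | add φ ψ => φ.aeval v + ψ.aeval v
  | mul φ ψ => φ.aeval v * ψ.aeval v

section aeval

variable {B : Type w} [Semiring B] [Algebra R B] (v : σ → B)

/-- Unfolding of `aeval` at a variable leaf. [cite: LiTzameretWang2018, Def. 2.1 (arXiv Def. 9)] -/
@[simp] theorem aeval_var (i : σ) : (var i : NCFormula R σ).aeval v = v i := rfl
/-- Unfolding of `aeval` at a constant leaf. [cite: LiTzameretWang2018, Def. 2.1 (arXiv Def. 9)] -/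
@[simp] theorem aeval_const (c : R) : (const c : NCFormula R σ).aeval v = algebraMap R B c := rfl
/-- Unfolding of `aeval` at a plus gate. [cite: LiTzameretWang2018, Def. 2.1 (arXiv Def. 9)] -/
@[simp] theorem aeval_add (φ ψ : NCFormula R σ) : (add φ ψ).aeval v = φ.aeval v + ψ.aeval v := rfl
/-- Unfolding of `aeval` at a product gate (ordered product). [cite: LiTzameretWang2018, Def. 2.1 (arXiv Def. 9)] -/
@[simp] theorem aeval_mul (φ ψ : NCFormula R σ) : (mul φ ψ).aeval v = φ.aeval v * ψ.aeval v := rfl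

/-- **Functoriality**: an `R`-algebra map commutes with evaluation, `f (𝔉(v)) = 𝔉(f ∘ v)` — the
algebraic content of "substitute, then evaluate". [cite: LiTzameretWang2018, Def. 2.1 (arXiv Def. 9)] -/
theorem map_aeval {C : Type*} [Semiring C] [Algebra R C] (f : B →ₐ[R] C) (φ : NCFormula R σ) :
    f (φ.aeval v) = φ.aeval (f ∘ v) := by
  induction φ with
  | var i => rfl
  | const c => exact f.commutes c
  | add φ ψ ihφ ihψ => rw [aeval_add, map_add, ihφ, ihψ, aeval_add]
  | mul φ ψ ihφ ihψ => rw [aeval_mul, map_mul, ihφ, ihψ, aeval_mul]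

end aeval

/-- **Free-algebra semantics**: the non-commutative polynomial in `R⟨x_i : i ∈ σ⟩ =
MonoidAlgebra R (FreeMonoid σ)` computed by a formula — `x_i ↦` the letter `x_i`, `c ↦ c·1`, plus
gate `↦` sum, product gate `↦` ordered (non-commutative) product.  This is LTW's "a non-commutative
formula computes a non-commutative polynomial in the natural way"; contrast the tree's
`NCFormula.eval` (Hrubeš–Yehudayoff: commuting variables). [cite: LiTzameretWang2018, §1.3.2 and Def. 2.1 (arXiv Def. 9)] -/
noncomputable def evalFree (φ : NCFormula R σ) : MonoidAlgebra R (FreeMonoid σ) :=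
  φ.aeval fun i => MonoidAlgebra.of R (FreeMonoid σ) (FreeMonoid.of i)

/-- Unfolding: `evalFree` is `aeval` at the letters. [cite: LiTzameretWang2018, §1.3.2] -/
theorem evalFree_eq_aeval (φ : NCFormula R σ) :
    φ.evalFree = φ.aeval fun i => MonoidAlgebra.of R (FreeMonoid σ) (FreeMonoid.of i) := rfl

/-- `evalFree (x_i)` is the letter `x_i`. [cite: LiTzameretWang2018, §1.3.2] -/
@[simp] theorem evalFree_var (i : σ) :
    (var i : NCFormula R σ).evalFree = MonoidAlgebra.of R (FreeMonoid σ) (FreeMonoid.of i) := rfl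
/-- `evalFree (c)` is the scalar `c`. [cite: LiTzameretWang2018, §1.3.2] -/
@[simp] theorem evalFree_const (c : R) :
    (const c : NCFormula R σ).evalFree = algebraMap R (MonoidAlgebra R (FreeMonoid σ)) c := rfl
/-- `evalFree` of a plus gate. [cite: LiTzameretWang2018, §1.3.2] -/
@[simp] theorem evalFree_add (φ ψ : NCFormula R σ) :
    (add φ ψ).evalFree = φ.evalFree + ψ.evalFree := rfl
/-- `evalFree` of a product gate: the ordered product. [cite: LiTzameretWang2018, §1.3.2] -/
@[simp] theorem evalFree_mul (φ ψ : NCFormula R σ) :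
    (mul φ ψ).evalFree = φ.evalFree * ψ.evalFree := rfl

/-- **Substitution = evaluation**: substituting `x_i ↦ v i` (the `R`-algebra map out of the free
algebra determined by `v`) into the polynomial computed by `𝔉` gives the value of `𝔉` at `v`.  In
particular the two conditions of an NC-IPS certificate, which LTW state as substitutions
`𝔉(x̄, 0̄)`, `𝔉(x̄, F̄)` into the polynomial `𝔉 ∈ 𝔽⟨x̄, ȳ⟩`, are evaluations of the formula.
[cite: LiTzameretWang2018, Def. 1.2 (arXiv Def. 2) with Def. 2.1] -/
theorem lift_evalFree {B : Type w} [Semiring B] [Algebra R B] (v : σ → B) (φ : NCFormula R σ) :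
    MonoidAlgebra.lift R B (FreeMonoid σ) (FreeMonoid.lift v) φ.evalFree = φ.aeval v := by
  rw [evalFree_eq_aeval, map_aeval]
  congr 1
  funext i
  simp

end Literature.Barriers.ValiantsHypothesis.NCFormula

namespace Literature.Computability.MetaComplexity

namespace NCIPS

open Literature.Computability.Complexity
open Literature.Barriers.ValiantsHypothesis (NCFormula)

noncomputable section

universe u v

variable (R : Type u) [CommRing R] {ν : Type v}

/-! ### Certificates written as formulas (LTW Def. 1.2 with "written as a non-commutative formula") -/

/-- **NC-IPS certificate of formula size `≤ s` for one hypothesis `P`.**  LTW Def. 1.2 for the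
system `{Boolean axioms, commutator axioms, P(x̄)}` over `R⟨x_i : i ∈ ν⟩`: there are finitely many
axioms `g₀, …, g_{m-1}` (the tree's `NCIPS.IsAxiom`: `x_i x_i - x_i`, `x_i x_j - x_j x_i`; LTW's
Boolean axiom `x_i(1 - x_i)` is `-`(ours), a sign the cofactors absorb) and a NON-COMMUTATIVE FORMULA
`𝔉` in the letters `x_i` (`Sum.inl i`), placeholders `y_j` (`Sum.inr (Sum.inl j)`) and one
placeholder `z` (`Sum.inr (Sum.inr ())`), of size (number of nodes) at most `s`, such that
`𝔉(x̄, 0̄, 0) = 0` and `𝔉(x̄, g₀, …, g_{m-1}, P) = 1` in `R⟨x̄⟩` (substitutions into the polynomial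
computed by `𝔉`, = evaluations of `𝔉` by `NCFormula.lift_evalFree`).  "The size of a
non-commutative IPS refutation is the minimal size of a non-commutative formula computing [it]", so
this says: the NC-IPS refutation size of the system is `≤ s`.
[cite: LiTzameretWang2018, Def. 1.2 (arXiv Def. 2 / Def. 14) and Def. 2.1 (size)] -/
def HasFormulaCertificateFor (s : ℕ) (P : MonoidAlgebra R (FreeMonoid ν)) : Prop :=
  ∃ (m : ℕ) (g : Fin m → MonoidAlgebra R (FreeMonoid ν))
    (𝔉 : NCFormula R (ν ⊕ (Fin m ⊕ Unit))),
    (∀ j, IsAxiom (g j)) ∧ 𝔉.size ≤ s ∧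
      𝔉.aeval (Sum.elim (X R) 0) = 0 ∧
      𝔉.aeval (Sum.elim (X R) (Sum.elim g fun _ => P)) = 1

/-- **NC-IPS certificate of formula size `≤ s` that the CNF `φ` is unsatisfiable**: a certificate
for the hypothesis `tr(φ) = 1 - P_φ` ("`φ` holds": `P_φ = clauseProduct R φ` is the polynomial
computed by `1 - tr(φ)`, equal to `1` exactly at the 0-1 points satisfying `φ`, `NCIPS.lean`).
[cite: LiTzameretWang2018, Def. 1.2 (arXiv Def. 2) with Def. 1.3 and Def. 1.6] -/
def HasFormulaCertificate (s : ℕ) (φ : CNF ν) : Prop :=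
  HasFormulaCertificateFor R s (1 - clauseProduct R φ)

/-! ### LTW's translation `tr` of propositional formulas -/

/-- **LTW's translation `tr`** of a propositional formula into a non-commutative polynomial, in this
directory's convention `1 = true` (`NCIPS.lean`): `tr(x_i) = 1 - x_i`, `tr(false) = 1`,
`tr(true) = 0`, `tr(¬T) = 1 - tr(T)`, `tr(T₁ ∧ T₂) = 1 - (1 - tr T₁)(1 - tr T₂)`,
`tr(T₁ ∨ T₂) = tr(T₁) · tr(T₂)` — so that `tr(T)` is `0` at the 0-1 points satisfying `T` and `1`
at those falsifying it (`boolEval_tr`).  LTW's own `tr(x_i) := x_i` belongs to the opposite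
convention `0 = true`; the two differ by the involution `x_i ↦ 1 - x_i` of `R⟨x⟩`.
[cite: LiTzameretWang2018, Def. 1.3 (arXiv Def. 3)] -/
def tr : PropForm ν → MonoidAlgebra R (FreeMonoid ν)
  | .var i => 1 - X R i
  | .const b => if b then 0 else 1
  | .neg T => 1 - tr T
  | .conj T₁ T₂ => 1 - (1 - tr T₁) * (1 - tr T₂)
  | .disj T₁ T₂ => tr T₁ * tr T₂

/-- **NC-IPS certificate of formula size `≤ s` of `tr(¬T)`** — the object of LTW Thm. 1.4: a
certificate for the system `{Boolean axioms, commutator axioms, tr(¬T)}` (`T` a tautology iff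
`tr(¬T) = 1 - tr(T)` has no 0-1 root). [cite: LiTzameretWang2018, Def. 1.2 with Def. 1.3 and Thm. 1.4 (statement shape)] -/
def HasFormulaCertificateOfTaut (s : ℕ) (T : PropForm ν) : Prop :=
  HasFormulaCertificateFor R s (tr R (.neg T))

variable {R}

/-! ### Unfolding and values of `tr` at 0-1 points -/

/-- `tr` of a variable. [cite: LiTzameretWang2018, Def. 1.3] -/
@[simp] theorem tr_var (i : ν) : tr R (.var i) = 1 - X R i := rfl
/-- `tr(false) = 1`, `tr(true) = 0`. [cite: LiTzameretWang2018, Def. 1.3] -/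
@[simp] theorem tr_const (b : Bool) : tr R (.const b : PropForm ν) = if b then 0 else 1 := rfl
/-- `tr(¬T) = 1 - tr(T)`. [cite: LiTzameretWang2018, Def. 1.3] -/
@[simp] theorem tr_neg (T : PropForm ν) : tr R (.neg T) = 1 - tr R T := rfl
/-- `tr(T₁ ∧ T₂) = 1 - (1 - tr T₁)(1 - tr T₂)`. [cite: LiTzameretWang2018, Def. 1.3] -/
@[simp] theorem tr_conj (T₁ T₂ : PropForm ν) :
    tr R (.conj T₁ T₂) = 1 - (1 - tr R T₁) * (1 - tr R T₂) := rfl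
/-- `tr(T₁ ∨ T₂) = tr(T₁) · tr(T₂)`. [cite: LiTzameretWang2018, Def. 1.3] -/
@[simp] theorem tr_disj (T₁ T₂ : PropForm ν) : tr R (.disj T₁ T₂) = tr R T₁ * tr R T₂ := rfl

/-- The translation of the positive literal is `litWord`: `tr(x_i) = 1 - x_i = litWord (i, true)`,
and of the negated variable `tr(¬x_i) = x_i = litWord (i, false)` (up to `1 - (1 - x) = x`).
[cite: LiTzameretWang2018, Def. 1.3 and Def. 1.6 (tr′)] -/
theorem tr_literal (l : Literal ν) :
    tr R (if l.2 then PropForm.var l.1 else .neg (.var l.1)) = litWord R l := by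
  rcases l with ⟨i, b⟩
  cases b <;> simp [litWord]

/-- **`tr` is faithful**: at the 0-1 point of an assignment `σ`, `tr(T)` evaluates to `0` if `σ`
satisfies `T` and to `1` otherwise ("`T` is a propositional tautology iff `tr(T) = 0` for every 0-1
assignment"). [cite: LiTzameretWang2018, Def. 1.3 (arXiv Def. 3, the sentence following it)] -/
theorem boolEval_tr (σ : ν → Bool) (T : PropForm ν) :
    boolEval R σ (tr R T) = if T.eval σ then 0 else 1 := by
  induction T with
  | var i => cases h : σ i <;> simp [PropForm.eval, h]
  | const b => cases b <;> simp [PropForm.eval]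
  | neg T ih => cases h : T.eval σ <;> simp [PropForm.eval, h, ih]
  | conj T₁ T₂ ih₁ ih₂ =>
      cases h₁ : T₁.eval σ <;> cases h₂ : T₂.eval σ <;> simp [PropForm.eval, h₁, h₂, ih₁, ih₂]
  | disj T₁ T₂ ih₁ ih₂ =>
      cases h₁ : T₁.eval σ <;> cases h₂ : T₂.eval σ <;> simp [PropForm.eval, h₁, h₂, ih₁, ih₂]

/-- `T` is a tautology iff `tr(T)` vanishes at every 0-1 point (over a nontrivial `R`).
[cite: LiTzameretWang2018, Def. 1.3 (arXiv Def. 3, the sentence following it)] -/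
theorem isTautology_iff_boolEval_tr [Nontrivial R] (T : PropForm ν) :
    T.IsTautology ↔ ∀ σ : ν → Bool, boolEval R σ (tr R T) = 0 := by
  refine ⟨fun h σ => by rw [boolEval_tr, h σ, if_pos rfl], fun h σ => ?_⟩
  have := h σ
  rw [boolEval_tr] at this
  cases hT : T.eval σ
  · rw [hT] at this; exact absurd this (by simp)
  · rfl

/-! ### Soundness of formula certificates (evaluate at a 0-1 point) -/

/-- Every axiom vanishes at every 0-1 point. [cite: LiTzameretWang2018, Def. 1.2 (the axioms have all 0-1 points as common roots)] -/
theorem IsAxiom.boolEval_eq_zero {g : MonoidAlgebra R (FreeMonoid ν)} (hg : IsAxiom g)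
    (σ : ν → Bool) : boolEval R σ g = 0 := by
  rcases hg with ⟨i, rfl⟩ | ⟨i, j, -, rfl⟩
  · rw [map_sub, map_mul, boolEval_X]
    cases σ i <;> simp
  · rw [map_sub, map_mul, map_mul, boolEval_X, boolEval_X]
    exact sub_eq_zero.2 (mul_comm _ _)

/-- **Soundness**: if the system `{axioms, P}` has an NC-IPS formula certificate (of any size) then
`P` has no 0-1 root — evaluate `𝔉(x̄, ḡ, P) = 1` and `𝔉(x̄, 0̄, 0) = 0` at a 0-1 point where `P`
vanishes: both left-hand sides become the same element of `R`. [cite: LiTzameretWang2018, Def. 1.2 (arXiv Def. 2; "sound and complete", §1.3.3)] -/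
theorem HasFormulaCertificateFor.boolEval_ne_zero [Nontrivial R] {s : ℕ}
    {P : MonoidAlgebra R (FreeMonoid ν)} (h : HasFormulaCertificateFor R s P) (σ : ν → Bool) :
    boolEval R σ P ≠ 0 := by
  intro hP
  obtain ⟨m, g, 𝔉, hg, -, h0, h1⟩ := h
  have e0 := congrArg (boolEval R σ) h0
  have e1 := congrArg (boolEval R σ) h1
  rw [NCFormula.map_aeval, map_zero] at e0
  rw [NCFormula.map_aeval, map_one] at e1
  have hv : (boolEval R σ : MonoidAlgebra R (FreeMonoid ν) → R) ∘
        Sum.elim (X R) (Sum.elim g (fun _ : Unit => P))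
      = (boolEval R σ : MonoidAlgebra R (FreeMonoid ν) → R) ∘
        Sum.elim (X R) (0 : Fin m ⊕ Unit → MonoidAlgebra R (FreeMonoid ν)) := by
    funext w
    rcases w with i | j | u
    · rfl
    · simp [(hg j).boolEval_eq_zero σ]
    · simp [hP]
  rw [hv] at e1
  exact zero_ne_one (e0.symm.trans e1)

/-- **Soundness for CNFs**: a CNF with an NC-IPS formula certificate is unsatisfiable (over a
nontrivial `R`). [cite: LiTzameretWang2018, Def. 1.2 (arXiv Def. 2; soundness)] -/
theorem HasFormulaCertificate.not_satisfiable [Nontrivial R] {s : ℕ} {φ : CNF ν}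
    (h : HasFormulaCertificate R s φ) : ¬ φ.Satisfiable := by
  rintro ⟨σ, hσ⟩
  refine HasFormulaCertificateFor.boolEval_ne_zero h σ ?_
  rw [map_sub, map_one, boolEval_clauseProduct, hσ, if_pos rfl, sub_self]

/-- **Soundness for tautologies**: if `tr(¬T)` has an NC-IPS formula certificate then `T` is a
tautology (over a nontrivial `R`). [cite: LiTzameretWang2018, Def. 1.2 with Def. 1.3 (soundness)] -/
theorem HasFormulaCertificateOfTaut.isTautology [Nontrivial R] {s : ℕ} {T : PropForm ν}
    (h : HasFormulaCertificateOfTaut R s T) : T.IsTautology := by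
  intro σ
  have hne := HasFormulaCertificateFor.boolEval_ne_zero h σ
  rw [tr_neg, map_sub, map_one, boolEval_tr] at hne
  cases hT : T.eval σ
  · rw [hT] at hne; exact absurd (by simp) hne
  · rfl

/-- Monotonicity in the size bound. [cite: LiTzameretWang2018, Def. 1.2 (size of a refutation = minimal formula size)] -/
theorem HasFormulaCertificateFor.mono {s s' : ℕ} (hss' : s ≤ s') {P : MonoidAlgebra R (FreeMonoid ν)}
    (h : HasFormulaCertificateFor R s P) : HasFormulaCertificateFor R s' P := by
  obtain ⟨m, g, 𝔉, hg, hs, h0, h1⟩ := h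
  exact ⟨m, g, 𝔉, hg, hs.trans hss', h0, h1⟩

/-- Monotonicity in the size bound (CNF form). [cite: LiTzameretWang2018, Def. 1.2] -/
theorem HasFormulaCertificate.mono {s s' : ℕ} (hss' : s ≤ s') {φ : CNF ν}
    (h : HasFormulaCertificate R s φ) : HasFormulaCertificate R s' φ :=
  HasFormulaCertificateFor.mono hss' h

end

end NCIPS

end Literature.Computability.MetaComplexity
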